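import Mathlib
import Summits.Ventures.HodgeRepro2.T5DeltaTwistBilinForm
import Summits.Ventures.HodgeRepro2.T5TraceBaseChange
import Summits.Ventures.HodgeRepro2.T5BilinFormBaseChange

/-!
# T5GramBaseChange — the base change of §N2.9.2's trace form, read on the completed algebra

Tier-5 sub-step N2, §N2.9.2 of route/T5-N2-route-3.md (l. 63), the «completions» item, third
file (after `T5BilinFormBaseChange`: symplectic stays symplectic, and `T5TraceBaseChange`: the
trace commutes with base change).  Here the base change of file 92's form
`traceBilin hF K : BilinForm F (ι × κ → E)`, `(z, z′) ↦ tr_{E/F}(z̄ᵀ K z′)`, along `F → L`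
(`L` = a completion `F_v` in the route) is IDENTIFIED, through Mathlib's
`TensorProduct.piRight : L ⊗[F] (ι × κ → E) ≃ₗ[L] (ι × κ → L ⊗[F] E)`, with the SAME Gram
expression over the base-changed algebra `L ⊗[F] E` (= `E_v` at a non-split place, `E_w × E_w'`
at a split one): `(z, z′) ↦ tr_{(L ⊗ E)/L}(c(z)ᵀ K z′)`, where `c = 1 ⊗ star` is the conjugation
acting on the `E`-factor (`conjTensor`) and `K` is read in `L ⊗ E` through `1 ⊗ ·`.

* `conjAlgHom hF : E →ₐ[F] E` — `star` as an `F`-algebra endomorphism (it fixes `F` by `hF`);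
* `conjTensor L hF : L ⊗[F] E →ₐ[L] L ⊗[F] E`, `a ⊗ x ↦ a ⊗ star x` (`conjTensor_tmul`);
* `gramBilinC L hF K′` — the Gram expression `∑ᵢⱼ c(zᵢ) · K′ᵢⱼ · z′ⱼ` as an `L`-bilinear map;
* `traceBilinC L hF K′` — `tr_{(L ⊗ E)/L}` of it, pulled back along `piRight`;
* **`traceBilin_baseChange`** — `(traceBilin hF K).baseChange L = traceBilinC L hF (K.map (1 ⊗ ·))`,
  and its pointwise form `traceBilin_baseChange_apply`;
* `isAlt_and_nondegenerate_traceBilinC` — hence the completed form `traceBilinC` is symplectic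
  whenever file 92's form is (with `T5BilinFormBaseChange.isAlt_and_nondegenerate_baseChange`).

What stays prose of the «completions» item after this file: only the identification
`E ⊗_F F_v = ∏_{w ∣ v} E_w` itself (Kudla's splitting, a printed input).
-/

namespace Summit.Ventures.HodgeRepro2.T5GramBaseChange

open TensorProduct T5DeltaTwistTensor T5DeltaTwistBilinForm T5TraceBaseChange

variable {F E : Type*} [Field F] [Field E] [StarRing E] [Algebra F E]

/-- `star` as an `F`-algebra endomorphism of `E`, given that it fixes the image of `F`. -/
def conjAlgHom (hF : ∀ c : F, star (algebraMap F E c) = algebraMap F E c) : E →ₐ[F] E :=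
  { starRingEnd E with commutes' := fun c => hF c }

/-- `conjAlgHom hF` is `star` pointwise. -/
@[simp]
theorem conjAlgHom_apply (hF : ∀ c : F, star (algebraMap F E c) = algebraMap F E c) (x : E) :
    conjAlgHom hF x = star x :=
  rfl

variable (L : Type*) [Field L] [Algebra F L]

/-- The conjugation of the base-changed algebra `L ⊗[F] E` acting on the `E`-factor:
`a ⊗ x ↦ a ⊗ star x` (at a completion `L = F_v` this is the conjugation of `E_v = E ⊗_F F_v`). -/
noncomputable def conjTensor (hF : ∀ c : F, star (algebraMap F E c) = algebraMap F E c) :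
    L ⊗[F] E →ₐ[L] L ⊗[F] E :=
  Algebra.TensorProduct.map (AlgHom.id L L) (conjAlgHom hF)

/-- `conjTensor` on pure tensors: `a ⊗ x ↦ a ⊗ star x`. -/
@[simp]
theorem conjTensor_tmul (hF : ∀ c : F, star (algebraMap F E c) = algebraMap F E c) (a : L)
    (x : E) : conjTensor L hF (a ⊗ₜ[F] x) = a ⊗ₜ[F] star x := by
  simp [conjTensor]

variable {ι : Type*} [Fintype ι]

/-- The Gram expression `∑ᵢⱼ c(zᵢ) · K′ᵢⱼ · z′ⱼ` over the base-changed algebra, as an `L`-bilinear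
map (the analogue of file 90's `gram`, whose `gram_eq_sum` reads `∑ᵢⱼ star (xᵢ) · (Mᵢⱼ · yⱼ)`). -/
noncomputable def gramBilinC (hF : ∀ c : F, star (algebraMap F E c) = algebraMap F E c)
    (K' : Matrix ι ι (L ⊗[F] E)) : (ι → L ⊗[F] E) →ₗ[L] (ι → L ⊗[F] E) →ₗ[L] L ⊗[F] E :=
  LinearMap.mk₂ L (fun z z' => ∑ i, ∑ j, conjTensor L hF (z i) * (K' i j * z' j))
    (fun z₁ z₂ z' => by
      simp only [Pi.add_apply, map_add, add_mul, Finset.sum_add_distrib])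
    (fun c z z' => by
      simp only [Pi.smul_apply, map_smul, smul_mul_assoc, Finset.smul_sum])
    (fun z z₁ z₂ => by
      simp only [Pi.add_apply, mul_add, Finset.sum_add_distrib])
    (fun c z z' => by
      simp only [Pi.smul_apply, mul_smul_comm, Finset.smul_sum])

/-- `gramBilinC` unfolded: `∑ᵢⱼ c(zᵢ) · (K′ᵢⱼ · z′ⱼ)`. -/
@[simp]
theorem gramBilinC_apply (hF : ∀ c : F, star (algebraMap F E c) = algebraMap F E c)
    (K' : Matrix ι ι (L ⊗[F] E)) (z z' : ι → L ⊗[F] E) :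
    gramBilinC L hF K' z z' = ∑ i, ∑ j, conjTensor L hF (z i) * (K' i j * z' j) :=
  rfl

/-- On pure tensors the Gram expression over `L ⊗ E` is the pure tensor of the Gram expression:
`∑ᵢⱼ c(a ⊗ fᵢ) · (1 ⊗ Kᵢⱼ) · (b ⊗ gⱼ) = (a b) ⊗ gram K f g`. -/
theorem gramBilinC_tmul (hF : ∀ c : F, star (algebraMap F E c) = algebraMap F E c)
    (K : Matrix ι ι E) (a b : L) (f g : ι → E) :
    gramBilinC L hF (K.map (Algebra.TensorProduct.includeRight (R := F) (A := L)))
        (fun i => a ⊗ₜ[F] f i) (fun j => b ⊗ₜ[F] g j) =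
      (a * b) ⊗ₜ[F] gram K f g := by
  simp only [gramBilinC_apply, conjTensor_tmul, Matrix.map_apply,
    Algebra.TensorProduct.includeRight_apply, Algebra.TensorProduct.tmul_mul_tmul, one_mul,
    gram_eq_sum, TensorProduct.tmul_sum]

variable {κ : Type*} [Fintype κ] [DecidableEq ι] [DecidableEq κ]

/-- The trace form of the Gram expression over `L ⊗[F] E`, read on `L ⊗[F] (ι × κ → E)` through
`piRight`: `(z, z′) ↦ tr_{(L ⊗ E)/L}(∑ᵢⱼ c(zᵢ) · K′ᵢⱼ · z′ⱼ)`. -/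
noncomputable def traceBilinC (hF : ∀ c : F, star (algebraMap F E c) = algebraMap F E c)
    (K' : Matrix (ι × κ) (ι × κ) (L ⊗[F] E)) :
    LinearMap.BilinForm L (L ⊗[F] (ι × κ → E)) :=
  ((gramBilinC L hF K').compr₂ (Algebra.trace L (L ⊗[F] E))).compl₁₂
    (TensorProduct.piRight F L L (fun _ : ι × κ => E)).toLinearMap
    (TensorProduct.piRight F L L (fun _ : ι × κ => E)).toLinearMap

/-- `traceBilinC` unfolded: the trace of the Gram expression of the `piRight` images. -/
theorem traceBilinC_apply (hF : ∀ c : F, star (algebraMap F E c) = algebraMap F E c)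
    (K' : Matrix (ι × κ) (ι × κ) (L ⊗[F] E)) (z z' : L ⊗[F] (ι × κ → E)) :
    traceBilinC L hF K' z z' =
      Algebra.trace L (L ⊗[F] E)
        (gramBilinC L hF K' (TensorProduct.piRight F L L (fun _ : ι × κ => E) z)
          (TensorProduct.piRight F L L (fun _ : ι × κ => E) z')) :=
  rfl

/-- **The base change of §N2.9.2's form is the same form over the base-changed algebra**:
`(traceBilin hF K).baseChange L = traceBilinC L hF (K.map (1 ⊗ ·))` as bilinear forms on
`L ⊗[F] (ι × κ → E)`. -/
theorem traceBilin_baseChange [FiniteDimensional F E]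
    (hF : ∀ c : F, star (algebraMap F E c) = algebraMap F E c)
    (K : Matrix (ι × κ) (ι × κ) E) :
    (traceBilin hF K).baseChange L =
      traceBilinC L hF (K.map (Algebra.TensorProduct.includeRight (R := F) (A := L))) := by
  apply TensorProduct.AlgebraTensorModule.ext
  intro a f
  apply TensorProduct.AlgebraTensorModule.ext
  intro b g
  rw [LinearMap.BilinForm.baseChange_tmul, traceBilin_apply, traceBilinC_apply]
  simp only [TensorProduct.piRight_apply, TensorProduct.piRightHom_tmul, gramBilinC_tmul,
    trace_tmul, Algebra.smul_def, mul_comm]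

/-- Pointwise form of `traceBilin_baseChange`. -/
theorem traceBilin_baseChange_apply [FiniteDimensional F E]
    (hF : ∀ c : F, star (algebraMap F E c) = algebraMap F E c)
    (K : Matrix (ι × κ) (ι × κ) E) (z z' : L ⊗[F] (ι × κ → E)) :
    (traceBilin hF K).baseChange L z z' =
      Algebra.trace L (L ⊗[F] E)
        (gramBilinC L hF (K.map (Algebra.TensorProduct.includeRight (R := F) (A := L)))
          (TensorProduct.piRight F L L (fun _ : ι × κ => E) z)
          (TensorProduct.piRight F L L (fun _ : ι × κ => E) z')) := by
  rw [traceBilin_baseChange, traceBilinC_apply]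

/-- The completed form is symplectic whenever the global one is: if `traceBilin hF K` is
alternating and non-degenerate over `F`, then `traceBilinC L hF (K.map (1 ⊗ ·))` is alternating and
non-degenerate over `L`. -/
theorem isAlt_and_nondegenerate_traceBilinC [FiniteDimensional F E]
    (hF : ∀ c : F, star (algebraMap F E c) = algebraMap F E c)
    (K : Matrix (ι × κ) (ι × κ) E)
    (h : (traceBilin hF K).IsAlt ∧ (traceBilin hF K).Nondegenerate) :
    (traceBilinC L hF (K.map (Algebra.TensorProduct.includeRight (R := F) (A := L)))).IsAlt ∧
      (traceBilinC L hF (K.map (Algebra.TensorProduct.includeRight (R := F) (A := L)))).Nondegenerate := by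
  rw [← traceBilin_baseChange]
  exact T5BilinFormBaseChange.isAlt_and_nondegenerate_baseChange h

end Summit.Ventures.HodgeRepro2.T5GramBaseChange
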